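import Literature.Geometry.Riemannian.SegmentInequalityPoincare
import Mathlib.MeasureTheory.Integral.MeanInequalities
import HarnessLib

/-!
# The (2,2)-Poincaré inequality on balls from the segment inequality (`Ric ≥ -(d-1)`)

Continuation of `SegmentInequalityPoincare.lean` (Cheeger–Colding 1996, Remark 2.82; Buser 1982):
the squared form, which is the one entering the energy estimates for harmonic replacements in
the Cheeger–Colding theory. For `u ∈ C¹` with an upper gradient `F` (`|du_x(w)| ≤ F(x)|w|_g`),
by Cauchy–Schwarz on `[0, 1]`,
  `|u(exp_x v) − u(x)|² ≤ |v|_g² ∫₀¹ F(exp_x(tv))² dt = |v|_g · (|v|_g ∫₀¹ F² ∘ γ_v)`,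
so `|u(x) − u(y)|² ≤ d(x, y) ℱ_{F²}(x, y) ≤ 2R ℱ_{F²}(x, y)` on `B_R(p)`, and the segment
inequality gives
  `∫_{B_R(p) × B_R(p)} |u(x) − u(y)|² ≤ 2R · 2R (2cosh R)^{d-1} · 2 Vol(B_R(p)) · ∫_{B_{2R}(p)} F²`.
We PROVE `sq_lintegral_Ioo_le` (`(∫₀¹ h)² ≤ ∫₀¹ h²`), `ofReal_sq_sub_le_mul_lintegral_sq`,
`ofReal_sq_sub_le_mul_segmentIntegral_sq`, `setLIntegral_prod_sq_sub_le` and, for smooth `u`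
with `F = |∇u|_g`, `setLIntegral_prod_sq_sub_le_gradient`.
No definitions, no named facts (D-0026). Groundwork for `CheegerColding1997_sphereStability`.

## References

* J. Cheeger, T. H. Colding, Ann. of Math. 144 (1996) 189–237, §2, Thm. 2.11, Remark 2.82.
  [CheegerColding1996]
* P. Buser, Ann. Sci. École Norm. Sup. (4) 15 (1982) 213–230, Lemma 5.1. [Buser1982]
-/

noncomputable section

open Bundle Set Function Filter MeasureTheory Manifold
open scoped Manifold ContDiff Topology ENNReal NNReal

namespace Literature.Geometry.Riemannian

open Lorentzian Lorentzian.PseudoRiemannianMetric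

/-- **Cauchy–Schwarz on the unit interval**: `(∫_{(0,1)} h)² ≤ ∫_{(0,1)} h²` for a.e.-measurable
`h : ℝ → [0, ∞]` (Hölder with exponents `2, 2` against the constant `1`, `|(0,1)| = 1`).
[folklore] -/
theorem sq_lintegral_Ioo_le {h : ℝ → ℝ≥0∞} (hh : AEMeasurable h (volume.restrict (Ioo (0 : ℝ) 1))) :
    (∫⁻ t in Ioo (0 : ℝ) 1, h t) ^ 2 ≤ ∫⁻ t in Ioo (0 : ℝ) 1, h t ^ 2 := by
  have hH := ENNReal.lintegral_mul_le_Lp_mul_Lq (volume.restrict (Ioo (0 : ℝ) 1))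
    Real.HolderConjugate.two_two hh aemeasurable_const (g := fun _ ↦ 1)
  simp only [Pi.mul_apply, mul_one, ENNReal.one_rpow, lintegral_const, Measure.restrict_apply,
    MeasurableSet.univ, univ_inter, Real.volume_Ioo, sub_zero, ENNReal.ofReal_one, mul_one,
    one_div] at hH
  have h2 : ∀ t, h t ^ (2 : ℝ) = h t ^ 2 := fun t ↦ by
    rw [show (2 : ℝ) = ((2 : ℕ) : ℝ) by norm_num, ENNReal.rpow_natCast]
  simp only [h2] at hH
  calc (∫⁻ t in Ioo (0 : ℝ) 1, h t) ^ 2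
      ≤ ((∫⁻ t in Ioo (0 : ℝ) 1, h t ^ 2) ^ (2 : ℝ)⁻¹) ^ 2 := by gcongr
    _ = ∫⁻ t in Ioo (0 : ℝ) 1, h t ^ 2 := by
        rw [← ENNReal.rpow_natCast, ← ENNReal.rpow_mul]; norm_num

section PoincareSq

variable {d : ℕ} {M : Type*} [TopologicalSpace M] [ChartedSpace (EuclideanSpace ℝ (Fin d)) M]
  [IsManifold 𝓘(ℝ, EuclideanSpace ℝ (Fin d)) ∞ M] [T2Space M]
  (g : PseudoRiemannianMetric 𝓘(ℝ, EuclideanSpace ℝ (Fin d)) ∞ (EuclideanSpace ℝ (Fin d))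
    (TangentSpace 𝓘(ℝ, EuclideanSpace ℝ (Fin d)) : M → Type _)) [g.HasLeviCivita]
  [CovariantDerivative.ContMDiffCovariantDerivative g.leviCivita 1]
  [CovariantDerivative.ContMDiffCovariantDerivative g.leviCivita ∞]

/-- **Squared differences along radial geodesics**: for `u ∈ C¹` with a Borel upper gradient `F`,
`|u(exp_x v) − u(x)|² ≤ g(v, v) ∫_{(0,1)} F(exp_x(tv))² dt`
(`ofReal_abs_sub_le_mul_lintegral_of_mvfderiv_le` and Cauchy–Schwarz `sq_lintegral_Ioo_le`).
[folklore] -/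
theorem ofReal_sq_sub_le_mul_lintegral_sq [MeasurableSpace M] [BorelSpace M] (hg : g.IsRiemannian)
    (hc : IsGeodesicallyComplete g.leviCivita) {u : M → ℝ}
    (hu : ContMDiff 𝓘(ℝ, (EuclideanSpace ℝ (Fin d))) 𝓘(ℝ, ℝ) 1 u) {F : M → ℝ≥0∞}
    (hFm : Measurable F)
    (hF : ∀ (x : M) (w : TangentSpace 𝓘(ℝ, (EuclideanSpace ℝ (Fin d))) x),
      ENNReal.ofReal |mvfderiv 𝓘(ℝ, (EuclideanSpace ℝ (Fin d))) u x w| ≤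
        F x * ENNReal.ofReal (Real.sqrt (g.val x w w)))
    (x : M) (v : TangentSpace 𝓘(ℝ, (EuclideanSpace ℝ (Fin d))) x) :
    ENNReal.ofReal (|u (expMap g.leviCivita x v) - u x| ^ 2) ≤
      ENNReal.ofReal (g.val x v v) *
        ∫⁻ t in Ioo (0 : ℝ) 1, F (expMap g.leviCivita x (t • v)) ^ 2 := by
  have h1 := ofReal_abs_sub_le_mul_lintegral_of_mvfderiv_le g hc hu hF x v
  have hvv : 0 ≤ g.val x v v := by
    by_cases hv : v = 0
    · simp [hv]
    · exact (hg x v hv).le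
  have hγ : Continuous fun t : ℝ ↦ expMap g.leviCivita x (t • v) := continuous_expMap_smul_line g hc x v
  have hmeas : AEMeasurable (fun t ↦ F (expMap g.leviCivita x (t • v)))
      (volume.restrict (Ioo (0 : ℝ) 1)) := (hFm.comp hγ.measurable).aemeasurable
  calc ENNReal.ofReal (|u (expMap g.leviCivita x v) - u x| ^ 2)
      = ENNReal.ofReal |u (expMap g.leviCivita x v) - u x| ^ 2 := by
        rw [ENNReal.ofReal_pow (abs_nonneg _)]
    _ ≤ (ENNReal.ofReal (Real.sqrt (g.val x v v)) *
          ∫⁻ t in Ioo (0 : ℝ) 1, F (expMap g.leviCivita x (t • v))) ^ 2 := by gcongr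
    _ = ENNReal.ofReal (g.val x v v) *
          (∫⁻ t in Ioo (0 : ℝ) 1, F (expMap g.leviCivita x (t • v))) ^ 2 := by
        rw [mul_pow, ← ENNReal.ofReal_pow (Real.sqrt_nonneg _), Real.sq_sqrt hvv]
    _ ≤ ENNReal.ofReal (g.val x v v) *
          ∫⁻ t in Ioo (0 : ℝ) 1, F (expMap g.leviCivita x (t • v)) ^ 2 := by
        gcongr; exact sq_lintegral_Ioo_le hmeas

/-- **`|u(x) − u(y)|² ≤ d(x, y) ℱ_{F²}(x, y)`**: along a minimal geodesic `γ_v` from `x` to `y`,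
`|v|_g = d(x, y)`, so `ofReal_sq_sub_le_mul_lintegral_sq` and the definition of the segment
integral (`le_segmentIntegral`) give the bound with the edistance factor. [folklore] -/
theorem ofReal_sq_sub_le_edist_mul_segmentIntegral_sq [MeasurableSpace M] [BorelSpace M]
    (hg : g.IsRiemannian) (hc : IsGeodesicallyComplete g.leviCivita) {u : M → ℝ}
    (hu : ContMDiff 𝓘(ℝ, (EuclideanSpace ℝ (Fin d))) 𝓘(ℝ, ℝ) 1 u) {F : M → ℝ≥0∞}
    (hFm : Measurable F)
    (hF : ∀ (x : M) (w : TangentSpace 𝓘(ℝ, (EuclideanSpace ℝ (Fin d))) x),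
      ENNReal.ofReal |mvfderiv 𝓘(ℝ, (EuclideanSpace ℝ (Fin d))) u x w| ≤
        F x * ENNReal.ofReal (Real.sqrt (g.val x w w)))
    (x y : M) :
    ENNReal.ofReal (|u x - u y| ^ 2) ≤
      g.edist hg x y * segmentIntegral g hg (fun z ↦ F z ^ 2) 0 1 x y := by
  haveI : LocallyCompactSpace M :=
    Manifold.locallyCompact_of_finiteDimensional 𝓘(ℝ, (EuclideanSpace ℝ (Fin d)))
  haveI : RegularSpace M := inferInstance
  haveI : T3Space M := inferInstance
  -- if `d(x, y) = 0` then `x = y`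
  by_cases hxy : x = y
  · subst hxy; simp
  have h0 : g.edist hg x y ≠ 0 := fun h ↦ hxy ((edist_eq_zero_iff hg).1 h)
  by_cases htop : g.edist hg x y = ⊤
  · rw [htop]
    by_cases hS : segmentIntegral g hg (fun z ↦ F z ^ 2) 0 1 x y = 0
    · -- then along admissible `v` (if any) ... the infimum over an empty family is `⊤ ≠ 0`,
      -- so there is an admissible `v`, and `|v|_g = d(x, y) = ⊤` is absurd.
      exfalso
      have hlt : segmentIntegral g hg (fun z ↦ F z ^ 2) 0 1 x y < 1 := by rw [hS]; exact one_pos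
      obtain ⟨v, hv, hvy, -⟩ := exists_lt_of_segmentIntegral_lt hg hlt
      have h1 := (isMinimizingUpTo_one_iff hg hc x v).1 hv
      rw [hvy, htop] at h1
      exact ENNReal.ofReal_ne_top h1
    · rw [ENNReal.top_mul hS]; exact le_top
  rw [mul_comm, ← ENNReal.div_le_iff_le_mul (Or.inl h0) (Or.inl htop)]
  refine le_segmentIntegral hg fun v hv hvy ↦ ?_
  rw [ENNReal.div_le_iff_le_mul (Or.inl h0) (Or.inl htop), mul_comm]
  have h1 := (isMinimizingUpTo_one_iff hg hc x v).1 hv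
  rw [hvy] at h1
  have hvv : 0 ≤ g.val x v v := by
    by_cases hv0 : v = 0
    · simp [hv0]
    · exact (hg x v hv0).le
  calc ENNReal.ofReal (|u x - u y| ^ 2)
      = ENNReal.ofReal (|u (expMap g.leviCivita x v) - u x| ^ 2) := by rw [← hvy, abs_sub_comm]
    _ ≤ ENNReal.ofReal (g.val x v v) *
          ∫⁻ t in Ioo (0 : ℝ) 1, F (expMap g.leviCivita x (t • v)) ^ 2 :=
        ofReal_sq_sub_le_mul_lintegral_sq g hg hc hu hFm hF x v
    _ = g.edist hg x y * (ENNReal.ofReal (Real.sqrt (g.val x v v)) *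
          ∫⁻ t in Ioo (0 : ℝ) 1, F (expMap g.leviCivita x (t • v)) ^ 2) := by
        rw [← mul_assoc, ← h1, ← ENNReal.ofReal_mul (Real.sqrt_nonneg _),
          Real.mul_self_sqrt hvv]

/-- **The (2,2)-Poincaré inequality on balls from the segment inequality** (Cheeger–Colding
1996, Remark 2.82; Buser 1982): under `Ric ≥ -(d-1) g` (connected, second countable, complete
Levi-Civita connection, `d ≥ 1`), for `u ∈ C¹` with a lower semicontinuous upper gradient `F`
and `B = B_R(p)`, `R > 0`:
`∫_{B × B} |u(x) − u(y)|² d(Vol × Vol) ≤ 2R · (2cosh R)^{d-1} 2R · 2 Vol(B) · ∫_{B_{2R}(p)} F²`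
(`|u(x) − u(y)|² ≤ d(x,y) ℱ_{F²}(x,y) ≤ 2R ℱ_{F²}(x,y)` on `B × B`, then
`setLIntegral_prod_segmentIntegral_le` with `D = 2R`, minimal geodesics of `B` inside `B_{2R}(p)`).
Dividing by `2 Vol(B)²`: `⨍_B |u − u_B|² ≤ 4R² (2cosh R)^{d-1} Vol(B)⁻¹ ∫_{B_{2R}(p)} F²`.
[cite: CheegerColding1996, §2, Remark 2.82] [cite: Buser1982, Lemma 5.1] -/
theorem setLIntegral_prod_sq_sub_le (hd : 0 < d) [ConnectedSpace M] [T3Space M]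
    [SecondCountableTopology M] [MeasurableSpace M] [BorelSpace M] (hg : g.IsRiemannian)
    (hc : IsGeodesicallyComplete g.leviCivita)
    (hRic : ∀ (x : M) (w : TangentSpace 𝓘(ℝ, (EuclideanSpace ℝ (Fin d))) x),
      -((d : ℝ) - 1) * g.val x w w ≤ g.leviCivita.ricci x w w)
    {u : M → ℝ} (hu : ContMDiff 𝓘(ℝ, (EuclideanSpace ℝ (Fin d))) 𝓘(ℝ, ℝ) 1 u) {F : M → ℝ≥0∞}
    (hFl : LowerSemicontinuous F)
    (hF : ∀ (x : M) (w : TangentSpace 𝓘(ℝ, (EuclideanSpace ℝ (Fin d))) x),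
      ENNReal.ofReal |mvfderiv 𝓘(ℝ, (EuclideanSpace ℝ (Fin d))) u x w| ≤
        F x * ENNReal.ofReal (Real.sqrt (g.val x w w)))
    (p : M) {R : ℝ} (hR : 0 < R) :
    ∫⁻ z in {x : M | g.edist hg p x < ENNReal.ofReal R} ×ˢ {x : M | g.edist hg p x < ENNReal.ofReal R},
        ENNReal.ofReal (|u z.1 - u z.2| ^ 2)
        ∂((riemannianMeasure (I := 𝓘(ℝ, (EuclideanSpace ℝ (Fin d))))
            (g.toContMDiffRiemannianMetric hg)).prod
          (riemannianMeasure (I := 𝓘(ℝ, (EuclideanSpace ℝ (Fin d))))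
            (g.toContMDiffRiemannianMetric hg))) ≤
      ENNReal.ofReal (2 * R) *
        (ENNReal.ofReal ((2 * Real.cosh R) ^ (d - 1)) * ENNReal.ofReal (2 * R) *
          (2 * (riemannianMeasure (I := 𝓘(ℝ, (EuclideanSpace ℝ (Fin d))))
              (g.toContMDiffRiemannianMetric hg)) {x : M | g.edist hg p x < ENNReal.ofReal R}) *
          ∫⁻ y in {x : M | g.edist hg p x < ENNReal.ofReal (2 * R)}, F y ^ 2
            ∂(riemannianMeasure (I := 𝓘(ℝ, (EuclideanSpace ℝ (Fin d))))
              (g.toContMDiffRiemannianMetric hg))) := by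
  set B : Set M := {x : M | g.edist hg p x < ENNReal.ofReal R} with hB_def
  set U : Set M := {x : M | g.edist hg p x < ENNReal.ofReal (2 * R)} with hU_def
  have hopen : ∀ r : ℝ, IsOpen {x : M | g.edist hg p x < ENNReal.ofReal r} := fun r ↦
    isOpen_lt ((continuous_edist hg).comp (continuous_const.prodMk continuous_id)) continuous_const
  have hBm : MeasurableSet B := (hopen R).measurableSet
  have hUm : MeasurableSet U := (hopen (2 * R)).measurableSet
  have hBD : ∀ x ∈ B, ∀ y ∈ B, g.edist hg x y ≤ ENNReal.ofReal (2 * R) := by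
    intro x hx y hy
    have hx' : g.edist hg p x < ENNReal.ofReal R := hx
    have hy' : g.edist hg p y < ENNReal.ofReal R := hy
    calc g.edist hg x y ≤ g.edist hg x p + g.edist hg p y := g.edist_triangle hg x p y
      _ ≤ ENNReal.ofReal R + ENNReal.ofReal R := by
          rw [g.edist_comm hg x p]; exact add_le_add hx'.le hy'.le
      _ = ENNReal.ofReal (2 * R) := by rw [← ENNReal.ofReal_add hR.le hR.le, two_mul]
  have hBU : ∀ x ∈ B, ∀ y ∈ B, ∀ v : TangentSpace 𝓘(ℝ, (EuclideanSpace ℝ (Fin d))) x,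
      IsMinimizingUpTo g hg x v 1 → expMap g.leviCivita x v = y →
        ∀ t ∈ Icc (0 : ℝ) 1, expMap g.leviCivita x (t • v) ∈ U :=
    fun x hx y hy v hv hvy t ht ↦ edist_expMap_smul_lt_of_isMinimizingUpTo g hg hc hx hy hv hvy ht
  have hF2l : LowerSemicontinuous fun z ↦ F z ^ 2 := by
    intro z c hc'
    -- `t ↦ t²` is monotone and continuous on `[0, ∞]`
    have hcont : Continuous fun t : ℝ≥0∞ ↦ t ^ 2 := ENNReal.continuous_pow 2
    have hmono : Monotone fun t : ℝ≥0∞ ↦ t ^ 2 := fun a b hab ↦ pow_le_pow_left' hab 2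
    exact (hcont.comp_lowerSemicontinuous hFl hmono) z c hc'
  -- pointwise bound on `B × B`
  have hptw : ∀ x ∈ B, ∀ y ∈ B, ENNReal.ofReal (|u x - u y| ^ 2) ≤
      ENNReal.ofReal (2 * R) * segmentIntegral g hg (fun z ↦ F z ^ 2) 0 1 x y := by
    intro x hx y hy
    refine (ofReal_sq_sub_le_edist_mul_segmentIntegral_sq g hg hc hu hFl.measurable hF x y).trans ?_
    gcongr
    exact hBD x hx y hy
  have hcosh : Real.cosh (2 * R / 2) = Real.cosh R := by rw [mul_div_cancel_left₀ R two_ne_zero]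
  calc ∫⁻ z in B ×ˢ B, ENNReal.ofReal (|u z.1 - u z.2| ^ 2) ∂_
      ≤ ∫⁻ z in B ×ˢ B, ENNReal.ofReal (2 * R) * segmentIntegral g hg (fun z ↦ F z ^ 2) 0 1 z.1 z.2 ∂_ :=
        setLIntegral_mono' (hBm.prod hBm) fun z hz ↦ hptw z.1 hz.1 z.2 hz.2
    _ = ENNReal.ofReal (2 * R) * ∫⁻ z in B ×ˢ B, segmentIntegral g hg (fun z ↦ F z ^ 2) 0 1 z.1 z.2 ∂_ :=
        lintegral_const_mul' _ _ ENNReal.ofReal_ne_top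
    _ ≤ ENNReal.ofReal (2 * R) * (ENNReal.ofReal ((2 * Real.cosh (2 * R / 2)) ^ (d - 1)) *
          ENNReal.ofReal (2 * R) *
          ((riemannianMeasure (I := 𝓘(ℝ, (EuclideanSpace ℝ (Fin d))))
              (g.toContMDiffRiemannianMetric hg)) B +
            (riemannianMeasure (I := 𝓘(ℝ, (EuclideanSpace ℝ (Fin d))))
              (g.toContMDiffRiemannianMetric hg)) B) *
          ∫⁻ y in U, F y ^ 2 ∂(riemannianMeasure (I := 𝓘(ℝ, (EuclideanSpace ℝ (Fin d))))
            (g.toContMDiffRiemannianMetric hg))) := by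
        gcongr
        exact setLIntegral_prod_segmentIntegral_le g hd hg hc hRic hBm hBm hUm (by linarith) hBD hBU
          hF2l
    _ = _ := by rw [hcosh, two_mul (riemannianMeasure _ B)]

/-- **The (2,2)-Poincaré inequality on balls for smooth functions**, `F = |∇u|_g`
(`F² = g⁻¹(du, du) = gradSq u`): under `Ric ≥ -(d-1) g`,
`∫_{B_R(p) × B_R(p)} |u(x) − u(y)|² ≤ 2R · (2cosh R)^{d-1} 2R · 2 Vol(B_R(p)) · ∫_{B_{2R}(p)} |∇u|²`.
[cite: CheegerColding1996, §2, Remark 2.82] [cite: Buser1982, Lemma 5.1] -/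
theorem setLIntegral_prod_sq_sub_le_gradient (hd : 0 < d) [ConnectedSpace M] [T3Space M]
    [SecondCountableTopology M] [MeasurableSpace M] [BorelSpace M] (hg : g.IsRiemannian)
    (hc : IsGeodesicallyComplete g.leviCivita)
    (hRic : ∀ (x : M) (w : TangentSpace 𝓘(ℝ, (EuclideanSpace ℝ (Fin d))) x),
      -((d : ℝ) - 1) * g.val x w w ≤ g.leviCivita.ricci x w w)
    {u : M → ℝ} (hu : ContMDiff 𝓘(ℝ, (EuclideanSpace ℝ (Fin d))) 𝓘(ℝ, ℝ) ∞ u)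
    (p : M) {R : ℝ} (hR : 0 < R) :
    ∫⁻ z in {x : M | g.edist hg p x < ENNReal.ofReal R} ×ˢ {x : M | g.edist hg p x < ENNReal.ofReal R},
        ENNReal.ofReal (|u z.1 - u z.2| ^ 2)
        ∂((riemannianMeasure (I := 𝓘(ℝ, (EuclideanSpace ℝ (Fin d))))
            (g.toContMDiffRiemannianMetric hg)).prod
          (riemannianMeasure (I := 𝓘(ℝ, (EuclideanSpace ℝ (Fin d))))
            (g.toContMDiffRiemannianMetric hg))) ≤
      ENNReal.ofReal (2 * R) *
        (ENNReal.ofReal ((2 * Real.cosh R) ^ (d - 1)) * ENNReal.ofReal (2 * R) *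
          (2 * (riemannianMeasure (I := 𝓘(ℝ, (EuclideanSpace ℝ (Fin d))))
              (g.toContMDiffRiemannianMetric hg)) {x : M | g.edist hg p x < ENNReal.ofReal R}) *
          ∫⁻ y in {x : M | g.edist hg p x < ENNReal.ofReal (2 * R)},
            ENNReal.ofReal (g.gradSq u y)
            ∂(riemannianMeasure (I := 𝓘(ℝ, (EuclideanSpace ℝ (Fin d))))
              (g.toContMDiffRiemannianMetric hg))) := by
  have hgs : ∀ y, ENNReal.ofReal (g.gradSq u y) = ENNReal.ofReal (Real.sqrt (g.gradSq u y)) ^ 2 := by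
    intro y
    rw [← ENNReal.ofReal_pow (Real.sqrt_nonneg _), Real.sq_sqrt (g.gradSq_nonneg hg u y)]
  simp only [hgs]
  refine setLIntegral_prod_sq_sub_le g hd hg hc hRic (hu.of_le (by exact_mod_cast le_top)) ?_
    (fun x w ↦ ?_) p hR
  · exact (ENNReal.continuous_ofReal.comp (Real.continuous_sqrt.comp
      (contMDiff_gradSq g hu).continuous)).lowerSemicontinuous
  · rw [← ENNReal.ofReal_mul (Real.sqrt_nonneg _)]
    exact ENNReal.ofReal_le_ofReal (abs_mvfderiv_le_sqrt_gradSq_mul_sqrt g hg u x w)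

end PoincareSq

end Literature.Geometry.Riemannian

end
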